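import Summits.BirchSwinnertonDyer.Rank1Residual.X11b.VisibilityRankOne
import Summits.BirchSwinnertonDyer.Rank1Residual.GaloisImage.CongruenceVisibilityPotMult
import HarnessLib

/-!
# BSD rank-≤1 residual cell: `BSD(E,p)` at a RANK-ONE pair with `p² ‖ #Ш_an` from Kolyvagin's index
# bound (upper half) and a VISIBLE `Ш(E)[p] ≠ 0` (lower half) — the count with FREE places of kind (iii′)

HONEST FRAMING (cell `b2b-bsdres-*`, verbatim): prove what is provable now; shrink each hard class
to its core with data; no claim beyond stated classes; COMBINATION classes deleted from PUBLISHED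
theorems only, CONSTRUCTION-shaped remainder typed; this is not "finishing BSD". PER-PAIR certificate
SHAPE (theorems only; no definition, no named fact, nothing booked); no lane verdict is changed.

Unit `b2b-bsdres-x11c`, GEN 25 (prover-b2b-bsdres-x11c-g25-0). Gen 4's `X11b/VisibilityRankOne.lean`
(`bsdp_of_kolyvagin_of_congr`, pair `403280bd1`) uses the SIMPLE visibility count: every place of `S`
must have `E'(K_v)[p] = 0`. At a multiplicative place `v` where both curves are NON-SPLIT (so
`#Ẽ'_ns(𝔽_v) = v + 1` may be divisible by `p`) that local factor is not available; the cell's refined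
machinery (`Literature/…/CongruenceVisibilityComparison.lean`: the count with comparison indices
`ι_v(θ)`; `GaloisImage/CongruenceVisibilityPotMult.lean`: `ι_v(θ) = 1` at a place of kind (iii′) —
`|j(E)|_v > 1`, `|j(E')|_v > 1`, same twist class `γ = -c₄/c₆`, `μ_p(K_v) = 1` — from Tate's
uniformisation, binder `hU2`) makes such places FREE. This file re-assembles gen 4's two halves on that
count, for `E` of ANY rank (`[E(K):pE(K)] = p^{rank}·#E(K)[p]`):

* `exists_sha_ne_zero_of_congr_of_rank_add_of_freePlaces` — visible `Ш(E/K)[p] ≠ 0` from a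
  `p`-congruent `E'` of rank `≥ rank E + [K:ℚ] + 1`, each place of `S` of kind (i) (`E'(K_v)[p] = 0`)
  or (iii′);
* `bsdp_of_kolyvagin_of_congr_of_freePlaces` — rank one over `ℚ`, `p` odd, `ρ̄_{E,p}` onto,
  `ord_p #Ш_an = 2`: Kolyvagin's Heegner datum with `ord_p [E(K):ℤ y_K] ≤ 1` (UPPER) + a `p`-congruent
  partner of rank `≥ 3` with places of kinds (i)/(iii′) (LOWER, + Cassels–Tate) ⟹ Miller's `BSD(E,p)`.

What the count pays (erratum GEN 25-1, docstring only; the two theorems and their proofs are unchanged):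
at a place of kind (i) the comparison index is bounded by the whole local Kummer condition,
`ι_v(θ) ≤ #𝓛_v(E') = #E'(K_v)[p] · #(𝓞_v/p) = #(𝓞_v/p)`, so a place `v ∣ p` of kind (i) still costs
`p^{[K_v:ℚ_p]}` (over `ℚ`: the place of `p` costs `p`) and the places `v ∤ p` of kind (i) cost nothing;
a place of kind (iii′) has `ι_v(θ) = 1` wherever it lies (`v ∣ p` allowed by the cited comparison
theorem); the proof nevertheless charges the crude total `∏_{v ∈ S} #(𝓞_v/p) = p^{[K:ℚ]}`, so the
hypothesis `rank E' ≥ rank E + [K:ℚ] + 1` is the same as in gen 4's simple count — the gain is only that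
multiplicative / potentially-multiplicative places of the same twist class no longer need
`E'(K_v)[p] = 0`. What is NOT covered: a place `v ∤ p` where `E'(K_v)[p] ≠ 0`
and the two curves are not both of kind (iii′) (e.g. `E'` split and `E` good there) — such a place must
be PAID with the refined certificate `exists_sha_ne_zero_of_congr_of_places` of the Literature series,
which this file does not re-assemble for positive rank.

First user: `X4/VisibilityPair377600dn1.lean` (the x5desc campaign's one `#Ш_an = 25` row; place `59`
non-split for both curves). References: Cremona–Mazur 2000 §3 [CremonaMazur2000]; Agashe–Stein 2002
Thm. 3.1 [AgasheStein2002]; McCallum 1991 §1 [McCallumLMS1991]; Gross 1991 Thm. 1.3 [GrossLMS1991];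
Silverman ATAEC V.5.3–5.4 [SilvermanATAEC1994]; Silverman AEC X.4.14 [SilvermanAEC2009]; Miller 2011
Def. 1.1 [Miller2011LMS].
-/

set_option autoImplicit false

noncomputable section

open scoped Classical

open WeierstrassCurve Literature.NumberTheory.EllipticCurves
  Literature.NumberTheory.EllipticCurves.Rank1Residual
  Literature.NumberTheory.EllipticCurves.Rank1Residual.Typed
  Summit.BirchSwinnertonDyer.Rank1Residual.GaloisImage
open NumberField IsDedekindDomain

namespace Summit.BirchSwinnertonDyer.Rank1Residual.X4

/-! ### §1. The visibility count for `E` of any rank with FREE places of kind (iii′) -/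

section Count

variable {K : Type} [Field K] [NumberField K] (W W' : WeierstrassCurve K) [W.IsElliptic]
  [W'.IsElliptic] {p : ℕ} [Fact p.Prime]

/-- **Visible `Ш(E/K)[p] ≠ 0` from a `p`-congruent curve of rank `≥ rank E(K) + [K:ℚ] + 1`, for `E`
of ANY rank, with places of kind (iii′) FREE.** Hypotheses: `p` odd, `θ : E'[p] ≅ E[p]`
`Γ_K`-equivariant, `S` a finite set of finite places outside which `E, E'` have good reduction and
which contains the places above `p`, `E(K)[p] = 0`, and every `v ∈ S` is either (i) a place with
`E'(K_v)[p] = 0`, or (iii′) a place with `|j(E)|_v > 1`, `|j(E')|_v > 1`, `γ(E) = r² γ(E')` in `K_v`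
(`γ = -c₄/c₆`) and `μ_p(K_v) = 1`. Then the comparison indices satisfy `ι_v(θ) ≤ #(𝓞_v/p)` at kind
(i) (`ι_v ≤ #𝓛_v(E') = #E'(K_v)[p]·#(𝓞_v/p)`) and `ι_v(θ) = 1` at kind (iii′)
(`TwistedKummer.relIndex_map_selmerLocalKer_eq_one_of_one_lt_valuation_j`, conditional on the Tate
uniformisation fact `hU2`), so `[E(K):pE(K)] · ∏ ι_v ≤ p^{rank E} · p^{[K:ℚ]} < p^{rank E'} ≤
[E'(K):pE'(K)]` and the KERNEL count `exists_sha_ne_zero_of_congr_of_relIndex_lt` applies.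
[cite: CremonaMazur2000, §3 pp. 19–22] [cite: AgasheStein2002, Thm. 3.1 and §3.5]
[cite: SilvermanATAEC1994, Ch. V Lemma 5.2 (c), Thm. 5.3, Cor. 5.4] -/
theorem exists_sha_ne_zero_of_congr_of_rank_add_of_freePlaces
    (hU2 : Silverman1994_thmV53_corV54_tateUniformisation.{0}) (hp2 : p ≠ 2)
    (θ : geomTorsion W' (p : ℤ) ≃+ geomTorsion W (p : ℤ))
    (hθ : ∀ (σ : Field.absoluteGaloisGroup K) (P : geomTorsion W' (p : ℤ)), θ (σ • P) = σ • θ P)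
    (S : Finset (HeightOneSpectrum (𝓞 K)))
    (hS : ∀ v : HeightOneSpectrum (𝓞 K), v ∉ S →
      W.HasGoodReductionAt v ∧ W'.HasGoodReductionAt v ∧ (p : 𝓞 K) ∉ v.asIdeal)
    (htors : Nat.card (AddSubgroup.torsionBy W.toAffine.Point (p : ℤ)) = 1)
    (hrank : W.mordellWeilRank + Module.finrank ℚ K + 1 ≤ W'.mordellWeilRank)
    (hplaces : ∀ v ∈ S,
      Nat.card (nsmulAddMonoidHom p :
          (W'.baseChange (v.adicCompletion K)).toAffine.Point →+ _).ker = 1 ∨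
      (1 < v.valuation K W.j ∧ 1 < v.valuation K W'.j ∧
        (∃ r : v.adicCompletion K, algebraMap K (v.adicCompletion K) (-(W.c₄ / W.c₆)) =
          r ^ 2 * algebraMap K (v.adicCompletion K) (-(W'.c₄ / W'.c₆))) ∧
        (∀ ζ : v.adicCompletion K, ζ ^ p = 1 → ζ = 1))) :
    ∃ c : W.sha, c ≠ 0 ∧ p • c = 0 := by
  have hp : p.Prime := Fact.out
  -- the local quotients `#(𝓞_v / p)` and their product `p^{[K:ℚ]}`
  set q : HeightOneSpectrum (𝓞 K) → ℕ := fun v ↦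
    Nat.card (v.adicCompletionIntegers K ⧸ Ideal.span {(p : v.adicCompletionIntegers K)}) with hq
  have hprod : ∏ v ∈ S, q v = p ^ Module.finrank ℚ K :=
    prod_natCard_quot_adicCompletionIntegers (p := p) S fun v hv ↦ (hS v hv).2.2
  have hqpos : ∀ v ∈ S, q v ≠ 0 := fun v hv ↦
    (Finset.prod_ne_zero_iff.mp (hprod ▸ pow_ne_zero _ hp.ne_zero)) v hv
  -- every comparison index is at most `#(𝓞_v / p)`
  have hι : ∀ v ∈ S, (selmerLocalKer W (v.adicCompletion K) (p : ℤ)).relIndex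
      ((selmerLocalKer W' (v.adicCompletion K) (p : ℤ)).map (h1Equiv θ hθ).toAddMonoidHom) ≤ q v := by
    intro v hv
    rcases hplaces v hv with hker | ⟨hj, hj', hγ, hμ⟩
    · calc _ ≤ Nat.card (W'.kummerLocalConditionAt (p : ℤ) (v.adicCompletion K)) :=
            (relIndex_map_selmerLocalKer_ne_zero_and_le W W' θ hθ v).2
        _ = q v := by
            rw [W'.natCard_kummerLocalConditionAt_adicCompletion v hp.ne_zero, hker, one_mul]
    · rw [TwistedKummer.relIndex_map_selmerLocalKer_eq_one_of_one_lt_valuation_j W v hU2 hp2 W' θ hθ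
        hj hj' hγ hμ]
      exact Nat.one_le_iff_ne_zero.mpr (hqpos v hv)
  refine exists_sha_ne_zero_of_congr_of_relIndex_lt W W' hp2 θ hθ S hS ?_
  rw [X11b.index_range_zsmul_eq_pow_rank_mul_card_torsionBy W hp.ne_zero, htors, mul_one]
  calc p ^ W.mordellWeilRank * ∏ v ∈ S, (selmerLocalKer W (v.adicCompletion K) (p : ℤ)).relIndex
          ((selmerLocalKer W' (v.adicCompletion K) (p : ℤ)).map (h1Equiv θ hθ).toAddMonoidHom)
      ≤ p ^ W.mordellWeilRank * ∏ v ∈ S, q v :=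
        Nat.mul_le_mul_left _ (Finset.prod_le_prod' hι)
    _ = p ^ (W.mordellWeilRank + Module.finrank ℚ K) := by rw [hprod, pow_add]
    _ < p ^ (W.mordellWeilRank + Module.finrank ℚ K + 1) :=
        Nat.pow_lt_pow_right hp.one_lt (Nat.lt_succ_self _)
    _ ≤ p ^ W'.mordellWeilRank := Nat.pow_le_pow_right hp.pos hrank
    _ ≤ _ := pow_mordellWeilRank_le_index_range_zsmul W' hp.ne_zero

end Count

/-! ### §2. Rank one, `ord_p #Ш_an = 2`: Kolyvagin + visibility with free places -/

section Assembly

variable (W : WeierstrassCurve ℚ) [W.IsElliptic] (p : ℕ) [Fact p.Prime]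

/-- **Rank one, odd `p`, `ρ̄_{E,p}` onto, `ord_p #Ш_an = 2`: `BSD(E,p)` from PUBLISHED theorems plus TWO
per-pair certificates — Kolyvagin's Heegner datum with `ord_p [E(K) : ℤ y_K] ≤ 1` (UPPER half) and a
`p`-CONGRUENT CURVE OF RANK `≥ 3` (LOWER half, visibility + Cassels–Tate), the places of `S` being
either of kind (i) (`E'(ℚ_v)[p] = 0`) or of kind (iii′) (`|j|_v > 1` twice, same twist class,
`μ_p(ℚ_v) = 1` — multiplicative or additive potentially-multiplicative places, FREE).** Gen 4's
`X11b.bsdp_of_kolyvagin_of_congr` with the count of §1 in place of the simple count; one more published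
binder, the Tate uniformisation `hU2` (Silverman ATAEC V.5.3 / Cor. 5.4). NOT a class theorem (per-pair
partner data); no label changes; the lane certifies.
[cite: McCallumLMS1991, §1 Theorem (Kolyvagin), p. 296] [cite: SilvermanAEC2009, Thm. X.4.14]
[cite: CremonaMazur2000, §3 and Table 1] [cite: AgasheStein2002, Thm. 3.1]
[cite: SilvermanATAEC1994, Ch. V Thm. 5.3, Cor. 5.4] [cite: Miller2011LMS, §1 and Def. 1.1] -/
theorem bsdp_of_kolyvagin_of_congr_of_freePlaces (hCT : exists_casselsTate_pairing (K := ℚ))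
    (hGZK : rank_eq_analyticRank_of_analyticRank_le_one)
    {N : ℕ} [NeZero N] {K : Type} [Field K] [NumberField K] (hKo : kolyvagin N W K)
    (hB : Kolyvagin1990_padicValNat_card_sha_le N W K) (hK : IsImaginaryQuadratic K)
    (hH : SatisfiesHeegnerHypothesis N K) {P : (W.baseChange K).toAffine.Point}
    (hP : IsHeegnerPoint N W K P) (hnt : ¬ IsOfFinAddOrder P)
    (hU2 : Silverman1994_thmV53_corV54_tateUniformisation.{0})
    (hp2 : p ≠ 2) (hρ : W.HasSurjectiveModNGaloisRep p)
    (hI : padicValNat p (AddSubgroup.zmultiples P).index ≤ 1)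
    (hr : W.analyticRank = 1) {s : ℚ} (hs : shaAn W = (s : ℂ)) (hv : padicValRat p s = 2)
    (W' : WeierstrassCurve ℚ) [W'.IsElliptic]
    (θ : geomTorsion W' (p : ℤ) ≃+ geomTorsion W (p : ℤ))
    (hθ : ∀ (σ : Field.absoluteGaloisGroup ℚ) (P : geomTorsion W' (p : ℤ)), θ (σ • P) = σ • θ P)
    (hrank : 3 ≤ W'.mordellWeilRank) (S : Finset (HeightOneSpectrum (𝓞 ℚ)))
    (hS : ∀ v : HeightOneSpectrum (𝓞 ℚ), v ∉ S →
      W.HasGoodReductionAt v ∧ W'.HasGoodReductionAt v ∧ (p : 𝓞 ℚ) ∉ v.asIdeal)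
    (hplaces : ∀ v ∈ S,
      Nat.card (nsmulAddMonoidHom p :
          (W'.baseChange (v.adicCompletion ℚ)).toAffine.Point →+ _).ker = 1 ∨
      (1 < v.valuation ℚ W.j ∧ 1 < v.valuation ℚ W'.j ∧
        (∃ r : v.adicCompletion ℚ, algebraMap ℚ (v.adicCompletion ℚ) (-(W.c₄ / W.c₆)) =
          r ^ 2 * algebraMap ℚ (v.adicCompletion ℚ) (-(W'.c₄ / W'.c₆))) ∧
        (∀ ζ : v.adicCompletion ℚ, ζ ^ p = 1 → ζ = 1))) :
    BSDp W p := by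
  obtain ⟨hrk, hfin⟩ := hGZK W (by omega)
  haveI : NeZero (p : ℚ) := ⟨by exact_mod_cast (Fact.out : p.Prime).ne_zero⟩
  have hirr : Irr W p := hasIrreducibleModPGaloisRep_of_hasSurjectiveModNGaloisRep W p hρ
  have hrank' : W.mordellWeilRank + Module.finrank ℚ ℚ + 1 ≤ W'.mordellWeilRank := by
    rw [hrk, hr, Module.finrank_self]; exact hrank
  -- LOWER half: a visible non-zero element of `Ш(E/ℚ)[p]`, then Cassels–Tate squareness
  have hdvd : p ∣ W.shaOrder :=
    dvd_shaOrder_of_exists_torsion W p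
      (exists_sha_ne_zero_of_congr_of_rank_add_of_freePlaces W W' hU2 hp2 θ hθ S hS
        ((X11b.natCard_torsionBy_point_eq_of_subsingleton W _ _ _).trans
          (natCard_torsionBy_eq_one_of_hasIrreducibleModPGaloisRep W p hirr)) hrank' hplaces)
  have hlow : MissingLowerBoundAt W p :=
    missingLowerBoundAt_of_casselsTate_of_pow_dvd W p hCT hfin hs (k := 1)
      (by rw [hv]; norm_num) (by simpa using hdvd)
  -- UPPER half: Kolyvagin
  have hup : MissingUpperBoundAt W p :=
    X11b.missingUpperBoundAt_of_padicValNat_shaOrder_le W p (k := 1)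
      (X11b.padicValNat_shaOrder_le_of_kolyvagin W p hKo hB hK hH hP hnt hp2 hρ hfin hI)
      hs (by rw [hv]; norm_num)
  exact bsdp_of_missingPPartAt W p hGZK (by omega) (missingPPartAt_of_lower_of_upper W p hlow hup)

end Assembly

end Summit.BirchSwinnertonDyer.Rank1Residual.X4

end
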